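import Summits.Ventures.PercRepro.MSTightCompletionDichotomy
import Summits.Ventures.PercRepro.MSTightConjTTheorem

/-!
# The completion dichotomy (H3) in general — the candidate Prop `CompletionDichotomy α` is a theorem

Dossier proofs/MINE1-theoremS.md, Addendum 57 §1. `completionDichotomy : CompletionDichotomy α`
(MSTightConjTCompletion.lean, Addendum 46): for EVERY family `F` of Marica–Schönheim excess one
with `∅, univ ∉ F`, empty core and full support (twins allowed) and every `r` with a tight trace,
`F₀ ∪ (P + r)` or `P ∪ (F₁ + r)` is tight.

The twin-free case is `completion_dichotomy_of_twinFree`; the general case is the twin-projection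
induction of Addendum 56 (2)–(3) (the proof of `conjT`): a twin pair `a ≠ b` of `F` has `a, b ≠ r`
(`eq_of_twin_of_tight_proj`), the projection `proj b F` keeps every hypothesis on the ground set
`{x // x ≠ b}`, and the completions commute with the twin projection
(`proj_completion0_of_ne`, `proj_completion1_of_ne`) and with the subtype transport
(`completion0_famMap`, `completion1_famMap`); twins of `F` are twins of both completions
(`twin_completion0_of_twin`, `twin_completion1_of_twin`), so tightness passes back through
`card_proj_of_twin` / `card_diffs_proj_of_twin` (`tight_proj_iff_of_twin`).
-/

namespace PercRepro.MSTight

open Finset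
open scoped FinsetFamily

section Transport

variable {β α : Type*} [DecidableEq β] [DecidableEq α]

/-- The transport of an `insert r`-image. -/
theorem famMap_image_insert (e : β ↪ α) (r : β) (G : Finset (Finset β)) :
    famMap e (G.image (insert r)) = (famMap e G).image (insert (e r)) := by
  ext A
  simp only [mem_famMap, mem_image]
  constructor
  · rintro ⟨s, ⟨t, ht, rfl⟩, rfl⟩
    exact ⟨t.map e, ⟨t, ht, rfl⟩, (map_insert e r t).symm⟩
  · rintro ⟨a, ⟨s, hs, rfl⟩, rfl⟩
    exact ⟨insert r s, ⟨s, hs, rfl⟩, map_insert e r s⟩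

/-- `completion0` transports. -/
theorem completion0_famMap (e : β ↪ α) (r : β) (G : Finset (Finset β)) :
    completion0 (e r) (famMap e G) = famMap e (completion0 r G) := by
  unfold completion0
  rw [famMap_union, part0_famMap, proj_famMap, famMap_image_insert]

/-- `completion1` transports. -/
theorem completion1_famMap (e : β ↪ α) (r : β) (G : Finset (Finset β)) :
    completion1 (e r) (famMap e G) = famMap e (completion1 r G) := by
  unfold completion1
  rw [famMap_union, partr_famMap, proj_famMap, famMap_image_insert]

end Transport

section TwinProjection

variable {α : Type*} [DecidableEq α] {r a b : α} {F : Finset (Finset α)}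

/-- The projection of a union. -/
theorem proj_union (b : α) (G₁ G₂ : Finset (Finset α)) :
    proj b (G₁ ∪ G₂) = proj b G₁ ∪ proj b G₂ :=
  image_union _ _

/-- The projection along `b ≠ r` of an `insert r`-image. -/
theorem proj_image_insert_of_ne (hbr : b ≠ r) (G : Finset (Finset α)) :
    proj b (G.image (insert r)) = (proj b G).image (insert r) := by
  unfold proj
  rw [image_image, image_image]
  apply image_congr
  intro t _
  exact erase_insert_of_ne hbr.symm

/-- The `r`-free part commutes with the projection along `b ≠ r`. -/
theorem part0_proj_of_ne (hbr : b ≠ r) : part0 r (proj b F) = proj b (part0 r F) := by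
  ext A
  simp only [mem_part0, mem_proj]
  constructor
  · rintro ⟨⟨t, ht, rfl⟩, hr⟩
    exact ⟨t, ⟨ht, fun h => hr (mem_erase.2 ⟨hbr.symm, h⟩)⟩, rfl⟩
  · rintro ⟨t, ⟨ht, hr⟩, rfl⟩
    exact ⟨⟨t, ht, rfl⟩, fun h => hr (mem_of_mem_erase h)⟩

/-- The `r`-part commutes with the projection along `b ≠ r`. -/
theorem partr_proj_of_ne (hbr : b ≠ r) : partr r (proj b F) = proj b (partr r F) := by
  ext A
  constructor
  · intro hA
    obtain ⟨hr, hA'⟩ := mem_partr.1 hA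
    obtain ⟨t', ht', hte⟩ := mem_proj.1 hA'
    have hrt' : r ∈ t' := by
      have h : r ∈ t'.erase b := by
        rw [hte]
        exact mem_insert_self r A
      exact mem_of_mem_erase h
    refine mem_proj.2 ⟨t'.erase r, mem_partr.2 ⟨notMem_erase r t', ?_⟩, ?_⟩
    · rw [insert_erase hrt']
      exact ht'
    · rw [erase_right_comm, hte, erase_insert hr]
  · intro hA
    obtain ⟨t, ht, rfl⟩ := mem_proj.1 hA
    obtain ⟨hr, ht'⟩ := mem_partr.1 ht
    refine mem_partr.2 ⟨fun h => hr (mem_of_mem_erase h), ?_⟩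
    rw [← erase_insert_of_ne hbr.symm]
    exact mem_proj.2 ⟨insert r t, ht', rfl⟩

/-- `completion0` commutes with the projection along `b ≠ r`. -/
theorem proj_completion0_of_ne (hbr : b ≠ r) :
    proj b (completion0 r F) = completion0 r (proj b F) := by
  unfold completion0
  rw [proj_union, part0_proj_of_ne hbr, proj_image_insert_of_ne hbr, proj_proj_comm r b]

/-- `completion1` commutes with the projection along `b ≠ r`. -/
theorem proj_completion1_of_ne (hbr : b ≠ r) :
    proj b (completion1 r F) = completion1 r (proj b F) := by
  unfold completion1
  rw [proj_union, partr_proj_of_ne hbr, proj_image_insert_of_ne hbr, proj_proj_comm r b]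

/-- Twins of `F` avoiding `r` are twins of `completion0 r F`. -/
theorem twin_completion0_of_twin (hab : Twin F a b) (har : a ≠ r) (hbr : b ≠ r) :
    Twin (completion0 r F) a b := by
  intro t ht
  rcases mem_union.1 ht with h | h
  · exact hab t (mem_part0.1 h).1
  · obtain ⟨p, hp, rfl⟩ := mem_image.1 h
    have hp' := twin_proj_of_twin hab har hbr p hp
    rw [mem_insert, mem_insert]
    exact ⟨fun h => h.elim (fun h => absurd h har) (fun h => Or.inr (hp'.1 h)),
      fun h => h.elim (fun h => absurd h hbr) (fun h => Or.inr (hp'.2 h))⟩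

/-- Twins of `F` avoiding `r` are twins of `completion1 r F`. -/
theorem twin_completion1_of_twin (hab : Twin F a b) (har : a ≠ r) (hbr : b ≠ r) :
    Twin (completion1 r F) a b := by
  intro t ht
  rcases mem_union.1 ht with h | h
  · exact twin_proj_of_twin hab har hbr t h
  · obtain ⟨p, hp, rfl⟩ := mem_image.1 h
    have hp' := twin_proj_of_twin hab har hbr p (partr_subset_proj_completion hp)
    rw [mem_insert, mem_insert]
    exact ⟨fun h => h.elim (fun h => absurd h har) (fun h => Or.inr (hp'.1 h)),
      fun h => h.elim (fun h => absurd h hbr) (fun h => Or.inr (hp'.2 h))⟩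

/-- Tightness is invariant under the projection along a twin. -/
theorem tight_proj_iff_of_twin {G : Finset (Finset α)} (hab : Twin G a b) (hne : a ≠ b) :
    Tight (proj b G) ↔ Tight G := by
  unfold Tight
  rw [card_proj_of_twin hab hne, card_diffs_proj_of_twin hab hne]

/-- **The lifting step:** the dichotomy for the twin projection gives it for `F`. -/
theorem completion_dichotomy_of_proj_twin (hab : Twin F a b) (hne : a ≠ b) (har : a ≠ r)
    (hbr : b ≠ r) (h : Tight (completion0 r (proj b F)) ∨ Tight (completion1 r (proj b F))) :
    Tight (completion0 r F) ∨ Tight (completion1 r F) := by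
  rcases h with h | h
  · left
    rw [← proj_completion0_of_ne hbr] at h
    exact (tight_proj_iff_of_twin (twin_completion0_of_twin hab har hbr) hne).1 h
  · right
    rw [← proj_completion1_of_ne hbr] at h
    exact (tight_proj_iff_of_twin (twin_completion1_of_twin hab har hbr) hne).1 h

end TwinProjection

section Induction

universe u

/-- **The completion dichotomy, by strong induction on the size of the ground set.** -/
theorem completionDichotomy_aux : ∀ (n : ℕ) (γ : Type u) [Fintype γ] [DecidableEq γ],
    Fintype.card γ = n → ∀ (F : Finset (Finset γ)) (r : γ), (F \\ F).card = F.card + 1 →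
      (∅ : Finset γ) ∉ F → (univ : Finset γ) ∉ F → (∀ a, ∃ t ∈ F, a ∉ t) →
        (∀ a, ∃ t ∈ F, a ∈ t) → Tight (proj r F) →
          Tight (completion0 r F) ∨ Tight (completion1 r F) := by
  intro n
  induction n using Nat.strong_induction_on with
  | _ n ih =>
  intro γ _ _ hn F r hF hE hU hcore hsupp hP
  by_cases htw : ∀ a b, Twin F a b → a = b
  · exact completion_dichotomy_of_twinFree htw hF hE hU hcore hsupp hP
  · push Not at htw
    obtain ⟨a, b, hab, hne⟩ := htw
    have har : a ≠ r := fun h => by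
      have hrb : Twin F r b := h ▸ hab
      exact hne (h.trans (eq_of_twin_of_tight_proj hF hP hrb).symm)
    have hbr : b ≠ r := fun h => by
      have hra : Twin F r a := h ▸ hab.symm
      have har' : a = r := eq_of_twin_of_tight_proj hF hP hra
      exact hne (har'.trans h.symm)
    -- the projection along `b`
    have hF'avoid : ∀ s ∈ proj b F, b ∉ s := fun s hs => notMem_of_mem_proj hs
    have hF'exc : (proj b F \\ proj b F).card = (proj b F).card + 1 := by
      rw [card_proj_of_twin hab hne, card_diffs_proj_of_twin hab hne]
      exact hF
    have hF'E : (∅ : Finset γ) ∉ proj b F := empty_notMem_proj_of_twin hab hne hE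
    have hF'U : univ.erase b ∉ proj b F := erase_univ_notMem_proj_of_twin hab hne hU
    have hF'P : Tight (proj r (proj b F)) := tight_proj_proj_of_twin hP hab hne har hbr
    -- the restriction to the subtype `{x // x ≠ b}`
    have hmap : famMap (Function.Embedding.subtype (· ≠ b))
        ((proj b F).image (Finset.subtype (· ≠ b))) = proj b F := famMap_subtype_image hF'avoid
    have hcard : Fintype.card {x : γ // x ≠ b} = n - 1 := by
      rw [Fintype.card_subtype_compl, Fintype.card_subtype_eq, hn]
    have hpos : 0 < n := by
      rw [← hn]
      exact Fintype.card_pos_iff.2 ⟨b⟩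
    have hlt : n - 1 < n := by omega
    have h1 : ((proj b F).image (Finset.subtype (· ≠ b)) \\
        (proj b F).image (Finset.subtype (· ≠ b))).card =
        ((proj b F).image (Finset.subtype (· ≠ b))).card + 1 := by
      rw [← card_diffs_famMap_eq_iff (Function.Embedding.subtype (· ≠ b)), hmap]
      exact hF'exc
    have h2 : (∅ : Finset {x : γ // x ≠ b}) ∉ (proj b F).image (Finset.subtype (· ≠ b)) := by
      intro h
      have h' := (mem_subtype_image hF'avoid).1 h
      rw [map_empty] at h'
      exact hF'E h'
    have h3 : (univ : Finset {x : γ // x ≠ b}) ∉ (proj b F).image (Finset.subtype (· ≠ b)) := by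
      intro h
      have h' := (mem_subtype_image hF'avoid).1 h
      rw [univ_map_subtype_ne] at h'
      exact hF'U h'
    have h4 : ∀ x : {x : γ // x ≠ b}, ∃ t ∈ (proj b F).image (Finset.subtype (· ≠ b)), x ∉ t := by
      intro x
      obtain ⟨t, ht, hxt⟩ := hcore x.1
      refine ⟨(t.erase b).subtype (· ≠ b), mem_image_of_mem _ (mem_proj.2 ⟨t, ht, rfl⟩), ?_⟩
      rw [mem_subtype]
      exact fun h => hxt (mem_of_mem_erase h)
    have h5 : ∀ x : {x : γ // x ≠ b}, ∃ t ∈ (proj b F).image (Finset.subtype (· ≠ b)), x ∈ t := by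
      intro x
      obtain ⟨t, ht, hxt⟩ := hsupp x.1
      exact ⟨(t.erase b).subtype (· ≠ b), mem_image_of_mem _ (mem_proj.2 ⟨t, ht, rfl⟩),
        mem_subtype.2 (mem_erase.2 ⟨x.2, hxt⟩)⟩
    have h6 : Tight (proj (⟨r, hbr.symm⟩ : {x : γ // x ≠ b})
        ((proj b F).image (Finset.subtype (· ≠ b)))) := by
      rw [← tight_famMap_iff (Function.Embedding.subtype (· ≠ b)), ← proj_famMap, hmap]
      exact hF'P
    have hIH := ih (n - 1) hlt {x : γ // x ≠ b} hcard _ _ h1 h2 h3 h4 h5 h6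
    have hlift : Tight (completion0 r (proj b F)) ∨ Tight (completion1 r (proj b F)) := by
      rcases hIH with h | h
      · left
        rw [← tight_famMap_iff (Function.Embedding.subtype (· ≠ b)), ← completion0_famMap,
          hmap] at h
        exact h
      · right
        rw [← tight_famMap_iff (Function.Embedding.subtype (· ≠ b)), ← completion1_famMap,
          hmap] at h
        exact h
    exact completion_dichotomy_of_proj_twin hab hne har hbr hlift

variable {α : Type*} [DecidableEq α] [Fintype α]

/-- **THE COMPLETION DICHOTOMY (H3) IS A THEOREM** — the candidate Prop of Addendum 46. -/
theorem completionDichotomy : CompletionDichotomy α := by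
  intro F r hF hE hU hcore hsupp hP
  exact completionDichotomy_aux _ α rfl F r hF hE hU hcore hsupp hP

/-- Conjecture (T) once more, this time from the completion dichotomy (the route of Addendum 46 §2;
`conjT` is the route of Addendum 56). -/
theorem conjT_of_completionDichotomy' : ConjT α :=
  conjT_of_completionDichotomy completionDichotomy

end Induction

end PercRepro.MSTight
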